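import Literature.NumberTheory.Automorphic.UnipotentConjCharExplicit
import Literature.NumberTheory.Automorphic.SiegelConeDyadicExplicit
import Literature.NumberTheory.Automorphic.AutomorphicRepsGLCuspFormsRapidDecay
import HarnessLib

/-!
# Weighted volumes of Siegel sets: `∫_{Z Ω A_{T₀}(t) K} f dμ < ∞` for weights `f ≪ δ_B(a)^θ`, `θ < 1`

Topic `NumberTheory/Automorphic`; namespace `Literature.NumberTheory.Automorphic`. Proof file
(theorems only). The tree proves that Siegel sets `Z · Ω · A_{T₀}(t) · K ⊆ GL_n(𝔸_K)` have finite
Haar measure (`measure_mul_siegelSet_lt_top`: the dyadic pieces of the cone indexed by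
`k ∈ ℕ^{n-1}` have measure `≤ C · δ_B(b_k)⁻¹ = C ∏_l χ_l^{k_l}`, `χ_l < 1`). This file proves the
weighted version used for theta-type integrands: if a function `f ≥ 0` on `GL_n(𝔸_K)` satisfies, on
products `diag(z(a)) · c` of a cone element with an element of a fixed compact set,
`f(diag(z(a)) c) ≤ C · δ_B(a)^θ` for some `θ ∈ [0, 1)` (`δ_B(a) = unipotentConjChar (z ∘ a) =
(∏_{i<j} aᵢ/aⱼ)^{[K:ℚ]}`, `unipotentConjChar_posRealIdele_eq`), then
**`∫_{Z Ω A_{T₀}(t) K} f dμ < ∞`** (`lintegral_siegelSet_lt_top_of_torus_bound`): on the `k`-th dyadic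
piece `f ≤ C' δ_B(b_k)^θ`, so the piece contributes `≤ C″ δ_B(b_k)^{θ-1} = C″ ∏_l (χ_l^{1-θ})^{k_l}`, a
convergent multiple geometric series (`ENNReal.tsum_prod_pow_ne_top`). The explicit dyadic
decomposition `siegelCone_subset_iUnion_dyadic_explicit` (generators `β_l` with `∏ = 1`,
non-increasing; box `Q₀` of cone elements with consecutive ratios in `[t, 2t]`) supplies the
bookkeeping `b_k · q ∈ A_{T₀}(t)` and `δ_B(q) ≤ M` on `Q₀`. (Godement, Sém. Bourbaki 257, §8:
integrals over Siegel sets reduce to integrals of the modulus over the cone; Borel (1963), §5,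
Thm. 5.8; this is the analytic half of the finiteness of the volume of `U(H)(L⁺)\U(H)(𝔸)` by
unfolding against `GL_N(𝔸_L)`, where `f` is the hermitian lattice-point count and `θ = 1 - 1/N`.)

## References

* R. Godement, *Domaines fondamentaux des groupes arithmétiques*, Sém. Bourbaki 257 (1962/63), §8
  [Godement1964].
* A. Borel, *Some finiteness properties of adele groups over number fields*, Publ. Math. IHÉS 16
  (1963), §5, Thm. 5.8 [Borel1963].
-/

noncomputable section

open MeasureTheory Measure NumberField IsDedekindDomain Matrix Set Filter Topology
open scoped MatrixGroups ENNReal NNReal Pointwise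

namespace Literature.NumberTheory.Automorphic

section Weighted

variable {n : ℕ} {K : Type} [Field K] [NumberField K]

/-- The modulus `q ↦ δ_B(q) = (∏_{i<j} qᵢ/qⱼ)^{[K:ℚ]}` is a continuous function of the torus
parameter (`unipotentConjChar_posRealIdele_eq`). [folklore] -/
private theorem continuous_unipotentConjChar_posRealIdele [LocallyCompactSpace (AdeleRing (𝓞 K) K)] :
    Continuous fun q : Fin n → ℝ≥0ˣ =>
      ((unipotentConjChar (fun i => posRealIdele K (q i)) : ℝ≥0) : ℝ) := by
  have hcoord : ∀ i : Fin n, Continuous fun q : Fin n → ℝ≥0ˣ => ((q i : ℝ≥0) : ℝ) := fun i =>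
    NNReal.continuous_coe.comp (Units.continuous_val.comp (continuous_apply i))
  have hfun : (fun q : Fin n → ℝ≥0ˣ => ((unipotentConjChar (fun i => posRealIdele K (q i)) : ℝ≥0) : ℝ)) =
      fun q => (∏ i : Fin n, ∏ j : Fin n,
        (if i < j then ((q i : ℝ≥0) : ℝ) / ((q j : ℝ≥0) : ℝ) else 1)) ^ Module.finrank ℚ K := by
    funext q; exact unipotentConjChar_posRealIdele_eq n K q
  rw [hfun]
  refine Continuous.pow (continuous_finsetProd _ fun i _ => continuous_finsetProd _ fun j _ => ?_) _
  split_ifs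
  · exact (hcoord i).div (hcoord j) fun q => (NNReal.coe_pos.2 (pos_iff_ne_zero.2 (q j).ne_zero)).ne'
  · exact continuous_const

/-- **Weighted Siegel-set volumes are finite.** Let `μ` be a Haar measure on `GL_n(𝔸_K)`, `Ω ⊆ B(𝔸_K)`
compact, `t > 0`, `Z ⊆ A_G` compact, and `f : GL_n(𝔸_K) → [0, ∞]`. Suppose that for every compact
`C₀ ⊆ GL_n(𝔸_K)` there is `C` with `f(diag(z(a)) · c) ≤ C · δ_B(a)^θ` for all `c ∈ C₀` and all cone
parameters `a` (`∏ aᵢ = 1`, `t aᵢ₊₁ ≤ aᵢ`), where `δ_B(a) = unipotentConjChar (z ∘ a)` and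
`0 ≤ θ < 1`. Then `∫_{Z · Ω · A_{T₀}(t) · K} f dμ < ∞`. (For `f = 1`, `θ = 0` this is
`measure_mul_siegelSet_lt_top`; Godement, Sém. Bourbaki 257, §8: Siegel-set integrals are integrals of
the modulus over the cone; Borel (1963), Thm. 5.8.) [cite: Godement1964, §8 (remark after Thm. 7)] -/
theorem lintegral_siegelSet_lt_top_of_torus_bound
    [MeasurableSpace (GL (Fin n) (AdeleRing (𝓞 K) K))] [BorelSpace (GL (Fin n) (AdeleRing (𝓞 K) K))]
    (μ : Measure (GL (Fin n) (AdeleRing (𝓞 K) K))) [μ.IsHaarMeasure]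
    {Ω : Set (GL (Fin n) (AdeleRing (𝓞 K) K))} (hΩc : IsCompact Ω)
    (hΩB : Ω ⊆ (standardParabolicGL (AdeleRing (𝓞 K) K) (id : Fin n → Fin n) :
      Set (GL (Fin n) (AdeleRing (𝓞 K) K))))
    {t : ℝ} (ht : 0 < t) {Z : Set (GL (Fin n) (AdeleRing (𝓞 K) K))} (hZc : IsCompact Z)
    (hZ : Z ⊆ Set.range (posRealScalar n K))
    {f : GL (Fin n) (AdeleRing (𝓞 K) K) → ℝ≥0∞} {θ : ℝ} (hθ0 : 0 ≤ θ) (hθ1 : θ < 1)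
    (hf : ∀ C₀ : Set (GL (Fin n) (AdeleRing (𝓞 K) K)), IsCompact C₀ → ∃ C : ℝ≥0,
      ∀ a : Fin n → ℝ≥0ˣ, (∏ i, ((a i : ℝ≥0) : ℝ)) = 1 →
        (∀ i j : Fin n, (j : ℕ) = (i : ℕ) + 1 → t * ((a j : ℝ≥0) : ℝ) ≤ ((a i : ℝ≥0) : ℝ)) →
        ∀ c ∈ C₀, f (posRealDiagonal n K a * c) ≤
          ((C * (unipotentConjChar (fun i => posRealIdele K (a i))) ^ θ : ℝ≥0) : ℝ≥0∞)) :
    ∫⁻ g in Z * (Ω * siegelCone n K t *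
        (standardMaximalCompactGL n K : Set (GL (Fin n) (AdeleRing (𝓞 K) K)))), f g ∂μ < ⊤ := by
  have hmeq := ‹BorelSpace (GL (Fin n) (AdeleRing (𝓞 K) K))›.measurable_eq
  subst hmeq
  letI : MeasurableSpace (GL (Fin n) (AdeleRing (𝓞 K) K)) := borel _
  haveI : BorelSpace (GL (Fin n) (AdeleRing (𝓞 K) K)) := ⟨rfl⟩
  haveI : T2Space (GL (Fin n) (AdeleRing (𝓞 K) K)) := t2Space_gl n K
  haveI : LocallyCompactSpace (AdeleRing (𝓞 K) K) := locallyCompactSpace_adeleRing' K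
  have hKc : IsCompact (standardMaximalCompactGL n K : Set (GL (Fin n) (AdeleRing (𝓞 K) K))) :=
    isCompact_standardMaximalCompactGL n K
  -- conjugates of `Ω` by the cone, and the compact set `C₀ = Z · Y · K`
  obtain ⟨Y, hYc, hY⟩ := exists_isCompact_conj_siegelCone_mem_of_subset (n := n) (K := K) ht hΩB hΩc
  set C₀ : Set (GL (Fin n) (AdeleRing (𝓞 K) K)) :=
    Z * Y * (standardMaximalCompactGL n K : Set (GL (Fin n) (AdeleRing (𝓞 K) K))) with hC₀
  have hC₀c : IsCompact C₀ := (hZc.mul hYc).mul hKc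
  obtain ⟨C, hC⟩ := hf C₀ hC₀c
  -- the explicit dyadic decomposition of the cone (parameter form, pieces inside the cone)
  obtain ⟨β, hβχ, -, -, P₀par, hP₀parc, -, hcov, hcone⟩ :=
    siegelCone_subset_iUnion_dyadic_param n K ht
  have hzcont : Continuous (posRealDiagonal n K) := by
    change Continuous fun a : Fin n → ℝ≥0ˣ =>
      glDiagonal n (AdeleRing (𝓞 K) K) fun i => posRealIdele K (a i)
    exact (continuous_glDiagonal (AdeleRing (𝓞 K) K)).comp
      (continuous_pi fun i => (continuous_posRealIdele K).comp (continuous_apply i))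
  set Q₀ : Set (GL (Fin n) (AdeleRing (𝓞 K) K)) := posRealDiagonal n K '' P₀par with hQ₀
  have hQ₀c : IsCompact Q₀ := hP₀parc.image hzcont
  have hQ₀r : Q₀ ⊆ Set.range (posRealDiagonal n K) := by
    rintro _ ⟨q, _, rfl⟩; exact ⟨q, rfl⟩
  -- `P₀ = Z Q₀` and the measure bound for the pieces
  set P₀ : Set (GL (Fin n) (AdeleRing (𝓞 K) K)) := Z * Q₀ with hP₀
  have hP₀c : IsCompact P₀ := hZc.mul hQ₀c
  have hP₀r : P₀ ⊆ Set.range (posRealDiagonal n K) := by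
    rintro _ ⟨z, hz, q, hq, rfl⟩
    obtain ⟨r, rfl⟩ := hZ hz
    obtain ⟨q', rfl⟩ := hQ₀r hq
    refine ⟨(fun _ => r) * q', ?_⟩
    rw [map_mul, posRealScalar_eq_posRealDiagonal_const]
  obtain ⟨Cm, hCm, hbound⟩ := exists_measure_conj_mul_mul_le (n := n) (K := K) μ hΩc hΩB hP₀c hP₀r
  -- dyadic generators and the contraction ratios `x_l = χ_l^{1-θ} < 1`
  set bk : (Fin (n - 1) → ℕ) → (Fin n → ℝ≥0ˣ) := fun k => ∏ l, β l ^ k l with hbk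
  set χ' : (Fin n → ℝ≥0ˣ) →* ℝ≥0 :=
    unipotentConjChar.comp ((posRealIdele K).compLeft (Fin n)) with hχ'
  have hχ'apply : ∀ a : Fin n → ℝ≥0ˣ,
      χ' a = unipotentConjChar (fun i => posRealIdele K (a i)) := fun a => rfl
  have hχ'pos : ∀ a, 0 < χ' a := fun a => by rw [hχ'apply]; exact unipotentConjChar_pos _
  set x : Fin (n - 1) → ℝ≥0 := fun l => (χ' (β l)⁻¹) ^ (1 - θ) with hx
  have hx1 : ∀ l, (x l : ℝ≥0∞) < 1 := fun l => by
    have h1 : χ' (β l)⁻¹ < 1 := by rw [hχ'apply]; exact hβχ l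
    have : x l < 1 := NNReal.rpow_lt_one h1 (by linarith)
    exact_mod_cast this
  have hχbk : ∀ k, χ' (bk k)⁻¹ = ∏ l, (χ' (β l)⁻¹) ^ k l := by
    intro k
    change χ' (∏ l, β l ^ k l)⁻¹ = ∏ l, (χ' (β l)⁻¹) ^ k l
    rw [← Finset.prod_inv_distrib, map_prod]
    refine Finset.prod_congr rfl fun l _ => ?_
    rw [← inv_pow, map_pow]
  -- the uniform bound of the modulus on the compact parameter box
  obtain ⟨MQ, hMQ⟩ := (hP₀parc.bddAbove_image
    (continuous_unipotentConjChar_posRealIdele (n := n) (K := K)).continuousOn)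
  have hMQ' : ∀ q ∈ P₀par, ((χ' q : ℝ≥0) : ℝ) ≤ max 1 MQ := fun q hq =>
    (hMQ ⟨q, hq, rfl⟩).trans (le_max_right _ _)
  -- the pieces `E_k` and the covering (as in `measure_mul_siegelSet_lt_top`)
  set E : (Fin (n - 1) → ℕ) → Set (GL (Fin n) (AdeleRing (𝓞 K) K)) := fun k =>
    (fun ω => posRealDiagonal n K (bk k)⁻¹ * ω * (posRealDiagonal n K (bk k)⁻¹)⁻¹) '' Ω * P₀ *
      (standardMaximalCompactGL n K : Set (GL (Fin n) (AdeleRing (𝓞 K) K))) with hE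
  have hEc : ∀ k, IsCompact (E k) := fun k =>
    ((hΩc.image ((continuous_const.mul continuous_id).mul continuous_const)).mul hP₀c).mul hKc
  have hzc : ∀ (r : ℝ≥0ˣ) (g : GL (Fin n) (AdeleRing (𝓞 K) K)),
      g * posRealScalar n K r = posRealScalar n K r * g := fun r g =>
    Subgroup.mem_center_iff.1 (posRealScalar_mem_center n K r) g
  have hsub : Z * (Ω * siegelCone n K t *
      (standardMaximalCompactGL n K : Set (GL (Fin n) (AdeleRing (𝓞 K) K)))) ⊆
      ⋃ k, {posRealDiagonal n K (bk k)} * E k := by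
    rintro _ ⟨z, hz, _, ⟨_, ⟨ω, hω, s, hs, rfl⟩, κ, hκ, rfl⟩, rfl⟩
    obtain ⟨r, rfl⟩ := hZ hz
    obtain ⟨k, hk⟩ := mem_iUnion.1 (hcov hs)
    obtain ⟨_, hb, q, hq, rfl⟩ := hk
    rw [mem_singleton_iff] at hb
    subst hb
    refine mem_iUnion.2 ⟨k, posRealDiagonal n K (bk k), rfl,
      (posRealDiagonal n K (bk k))⁻¹ * ω * posRealDiagonal n K (bk k) *
        (posRealScalar n K r * q) * κ, ?_, ?_⟩
    · refine ⟨_, ⟨_, ⟨ω, hω, ?_⟩, posRealScalar n K r * q, ⟨_, hz, q, hq, rfl⟩, rfl⟩, κ, hκ, rfl⟩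
      change posRealDiagonal n K (bk k)⁻¹ * ω * (posRealDiagonal n K (bk k)⁻¹)⁻¹ = _
      rw [map_inv, inv_inv]
    · change posRealDiagonal n K (bk k) * ((posRealDiagonal n K (bk k))⁻¹ * ω *
        posRealDiagonal n K (bk k) * (posRealScalar n K r * q) * κ) =
        posRealScalar n K r * (ω * (posRealDiagonal n K (bk k) * q) * κ)
      calc posRealDiagonal n K (bk k) * ((posRealDiagonal n K (bk k))⁻¹ * ω *
            posRealDiagonal n K (bk k) * (posRealScalar n K r * q) * κ)
          = ω * (posRealDiagonal n K (bk k) * posRealScalar n K r) * q * κ := by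
            simp only [mul_assoc, mul_inv_cancel_left]
        _ = ω * (posRealScalar n K r * posRealDiagonal n K (bk k)) * q * κ := by rw [hzc]
        _ = (ω * posRealScalar n K r) * posRealDiagonal n K (bk k) * q * κ := by
            simp only [mul_assoc]
        _ = (posRealScalar n K r * ω) * posRealDiagonal n K (bk k) * q * κ := by rw [hzc]
        _ = posRealScalar n K r * (ω * (posRealDiagonal n K (bk k) * q) * κ) := by
            simp only [mul_assoc]
  -- the weight on the `k`-th piece: `f ≤ C · MQ^θ · χ(b_k)^θ`
  have hMQ0 : (0 : ℝ) ≤ max 1 MQ := le_trans zero_le_one (le_max_left _ _)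
  set MQ' : ℝ≥0 := (⟨max 1 MQ, hMQ0⟩ : ℝ≥0) with hMQ'def
  have hpiece : ∀ k, ∀ g ∈ ({posRealDiagonal n K (bk k)} : Set _) * E k,
      f g ≤ ((C * MQ' ^ θ * (χ' (bk k)) ^ θ : ℝ≥0) : ℝ≥0∞) := by
    rintro k _ ⟨_, hb, e, he, rfl⟩
    rw [mem_singleton_iff] at hb
    subst hb
    obtain ⟨_, ⟨_, ⟨ω, hω, rfl⟩, p, hp, rfl⟩, κ, hκ, rfl⟩ := he
    obtain ⟨zr, hzr, g₀, hg₀, rfl⟩ := hp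
    obtain ⟨r, rfl⟩ := hZ hzr
    obtain ⟨q, hqP, rfl⟩ := hg₀
    -- the cone parameters `a' = b_k q`
    obtain ⟨ha'prod, ha'root⟩ := hcone k q hqP
    set a' : Fin n → ℝ≥0ˣ := bk k * q with ha'
    have ha'cone : posRealDiagonal n K a' ∈ siegelCone n K t := ⟨a', ha'prod, ha'root, rfl⟩
    -- `g = z(a') · c` with `c = z_r · (z(a')⁻¹ ω z(a')) · κ ∈ C₀`
    set y := (posRealDiagonal n K a')⁻¹ * ω * posRealDiagonal n K a' with hy
    have hyY : y ∈ Y := hY _ ha'cone ω hω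
    have hcC₀ : posRealScalar n K r * y * κ ∈ C₀ :=
      ⟨_, ⟨_, hzr, y, hyY, rfl⟩, κ, hκ, rfl⟩
    have hzc' : ∀ g h : GL (Fin n) (AdeleRing (𝓞 K) K),
        g * (posRealScalar n K r * h) = posRealScalar n K r * (g * h) := fun g h => by
      rw [← mul_assoc, hzc, mul_assoc]
    have hg : posRealDiagonal n K (bk k) *
        ((posRealDiagonal n K (bk k)⁻¹ * ω * (posRealDiagonal n K (bk k)⁻¹)⁻¹) *
          (posRealScalar n K r * posRealDiagonal n K q) * κ) =
        posRealDiagonal n K a' * (posRealScalar n K r * y * κ) := by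
      rw [hy, ha', map_mul]
      simp only [map_inv, inv_inv, _root_.mul_inv_rev, mul_assoc, mul_inv_cancel_left, hzc']
    beta_reduce
    rw [hg]
    refine (hC a' ha'prod ha'root _ hcC₀).trans ?_
    -- `χ(a') = χ(b_k) χ(q) ≤ χ(b_k) MQ`
    have hχa' : χ' a' = χ' (bk k) * χ' q := by rw [ha', map_mul]
    have hχq : χ' q ≤ MQ' := by
      rw [← NNReal.coe_le_coe]
      exact hMQ' q hqP
    have : (C * (unipotentConjChar (fun i => posRealIdele K (a' i))) ^ θ : ℝ≥0) ≤
        C * MQ' ^ θ * (χ' (bk k)) ^ θ := by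
      rw [← hχ'apply, hχa', NNReal.mul_rpow, mul_comm ((χ' (bk k)) ^ θ), ← mul_assoc]
      gcongr
    exact_mod_cast this
  -- summing over the pieces
  have hsumfin : (∑' k : Fin (n - 1) → ℕ, ∏ l, (x l : ℝ≥0∞) ^ k l) ≠ ⊤ :=
    ENNReal.tsum_prod_pow_ne_top (n - 1) (fun l => (x l : ℝ≥0∞)) hx1
  have hterm : ∀ k, ((C * MQ' ^ θ * (χ' (bk k)) ^ θ : ℝ≥0) : ℝ≥0∞) *
      μ (({posRealDiagonal n K (bk k)} : Set _) * E k) ≤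
      ((C * MQ' ^ θ : ℝ≥0) : ℝ≥0∞) * Cm * ∏ l, (x l : ℝ≥0∞) ^ k l := by
    intro k
    have hμ : μ (({posRealDiagonal n K (bk k)} : Set _) * E k) ≤
        Cm * unipotentConjChar (fun i => posRealIdele K ((bk k)⁻¹ i)) := by
      rw [Literature.MeasureTheory.Group.measure_singleton_mul μ]
      exact hbound (bk k)⁻¹
    -- `χ(b_k)^θ · χ(b_k⁻¹) = χ(b_k⁻¹)^{1-θ} = ∏ x_l^{k_l}`
    have hkey : (χ' (bk k)) ^ θ * χ' (bk k)⁻¹ = ∏ l, (x l) ^ k l := by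
      set y : ℝ≥0 := χ' (bk k)⁻¹ with hy
      have hy0 : y ≠ 0 := (hχ'pos _).ne'
      have hinv : χ' (bk k) = y⁻¹ := by rw [hy, map_inv, inv_inv]
      have h1 : (χ' (bk k)) ^ θ * y = y ^ (1 - θ) := by
        rw [hinv, NNReal.inv_rpow, ← NNReal.rpow_neg, show (1 : ℝ) - θ = -θ + 1 by ring,
          NNReal.rpow_add hy0, NNReal.rpow_one]
      rw [h1, hy, hχbk k, ← NNReal.finsetProd_rpow]
      refine Finset.prod_congr rfl fun l _ => ?_
      rw [hx]
      simp only
      rw [← NNReal.rpow_natCast, ← NNReal.rpow_natCast, ← NNReal.rpow_mul, ← NNReal.rpow_mul,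
        mul_comm]
    calc ((C * MQ' ^ θ * (χ' (bk k)) ^ θ : ℝ≥0) : ℝ≥0∞) * μ (({posRealDiagonal n K (bk k)} : Set _) * E k)
        ≤ ((C * MQ' ^ θ * (χ' (bk k)) ^ θ : ℝ≥0) : ℝ≥0∞) *
            (Cm * unipotentConjChar (fun i => posRealIdele K ((bk k)⁻¹ i))) := by gcongr
      _ = ((C * MQ' ^ θ : ℝ≥0) : ℝ≥0∞) * Cm * (((χ' (bk k)) ^ θ * χ' (bk k)⁻¹ : ℝ≥0) : ℝ≥0∞) := by
          rw [← hχ'apply]; push_cast; ring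
      _ = ((C * MQ' ^ θ : ℝ≥0) : ℝ≥0∞) * Cm * ∏ l, (x l : ℝ≥0∞) ^ k l := by
          rw [hkey]; push_cast; rfl
  calc ∫⁻ g in Z * (Ω * siegelCone n K t *
          (standardMaximalCompactGL n K : Set (GL (Fin n) (AdeleRing (𝓞 K) K)))), f g ∂μ
      ≤ ∫⁻ g in ⋃ k, {posRealDiagonal n K (bk k)} * E k, f g ∂μ := lintegral_mono_set hsub
    _ ≤ ∑' k, ∫⁻ g in {posRealDiagonal n K (bk k)} * E k, f g ∂μ := lintegral_iUnion_le _ _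
    _ ≤ ∑' k, ((C * MQ' ^ θ * (χ' (bk k)) ^ θ : ℝ≥0) : ℝ≥0∞) *
          μ (({posRealDiagonal n K (bk k)} : Set _) * E k) := by
        refine ENNReal.tsum_le_tsum fun k => ?_
        have hm : MeasurableSet (({posRealDiagonal n K (bk k)} : Set _) * E k) :=
          ((isCompact_singleton.mul (hEc k)).measurableSet)
        calc ∫⁻ g in {posRealDiagonal n K (bk k)} * E k, f g ∂μ
            ≤ ∫⁻ _ in {posRealDiagonal n K (bk k)} * E k,
                ((C * MQ' ^ θ * (χ' (bk k)) ^ θ : ℝ≥0) : ℝ≥0∞) ∂μ :=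
              setLIntegral_mono' hm fun g hg => hpiece k g hg
          _ = _ := setLIntegral_const _ _
    _ ≤ ∑' k : Fin (n - 1) → ℕ, ((C * MQ' ^ θ : ℝ≥0) : ℝ≥0∞) * Cm * ∏ l, (x l : ℝ≥0∞) ^ k l :=
        ENNReal.tsum_le_tsum hterm
    _ = ((C * MQ' ^ θ : ℝ≥0) : ℝ≥0∞) * Cm * ∑' k : Fin (n - 1) → ℕ, ∏ l, (x l : ℝ≥0∞) ^ k l :=
        ENNReal.tsum_mul_left
    _ < ⊤ := (ENNReal.mul_ne_top (ENNReal.mul_ne_top ENNReal.coe_ne_top hCm) hsumfin).lt_top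

end Weighted

end Literature.NumberTheory.Automorphic
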